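import Summits.RiemannHypothesis.RiemannHypothesis.Theorems.GroundBartaEvenWinsBeyondArchPhantomCertificateDeflated
import Literature.NumberTheory.LFunctions.WeilTwoPrimeCertificateDeflatedSector
import HarnessLib

/-!
# RiemannHypothesis / GroundBarta machinery — the phantom (format A′) deflated certificate: ODD-SECTOR soundness from parts

Helper file (`--supports stmt-RiemannHypothesis-18085 --as helper`), RH-free; prover B (g8) of unit `sr-gb-rung-b`.  The odd twin of seat
rh-explicit-weil-6's `WeilCert23X.weilTwoPrimeQuadratic_rankOne_bound_even_of_parts` (`…PhantomCertificateDeflatedEven`): for an ODD test function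
the even moments vanish (`weilMoment_even_of_odd`), so only the odd block (`p = 1`) of `P_r + Σ μ ĉ ĉᵀ` has to pass `checkBlockP`
(`WeilCert.core_nonnegR_block`, prover B g3); everything else is `WeilCert23X.weilTwoPrimeQuadratic_rankOne_bound_of_parts` verbatim.
[cite: Yoshida1992, §6, Thm 1 p. 310] Proved.

Use (c = 83/100 cell, certificate C83X of prover A g12): the odd-sector bound `deflBound_odd_…` can be assembled from the odd block `CertB1`
(rows `RowsPZO*`, `HpCheckO*`, `PmCheckO*`) alone — the odd Final / parity cell need not wait for the 164 even-block row files — and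
symmetrically the even-sector bound from `CertB0` with the even twin.
-/

set_option linter.dupNamespace false

noncomputable section

open Complex Finset MeasureTheory Set Filter
open scoped Real Topology BigOperators

namespace Summit.RiemannHypothesis.RiemannHypothesis.Theorems.EvenWinsBeyondArch

open Literature.NumberTheory.LFunctions
open Literature.Analysis.ValidatedNumerics.Numerics
open Literature.Analysis.SpecialFunctions

namespace WeilCert23X

variable {c : WeilCert23X}

/-- **Deflated ODD-SECTOR soundness from parts** (format A′): from `CellsOK₂₃` (old chain at `wL₀`), `XCellsOK` (phantom chain), admissibility,
scalars, the moment table, `β ≤ κ`, the ODD block of `P_r + Σ μ ĉ ĉᵀ` at Bessel weight `κ − β`, and the boosted tail level of `w₂₃ + P` beyond `T`: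
for every ODD test function `g` supported in `[-b, b]`, `β‖g‖² ≤ E₂₃(g) + Σ μ |Σ_k ĉ_k M_k(g)|²`. [folklore] -/
theorem weilTwoPrimeQuadratic_rankOne_bound_odd_of_parts {β : ℚ} {R : List (ℚ × ℕ × List ℚ)}
    (h23 : CellsOK₂₃ c.base.wL c.base.T c.cells) (hX : XCellsOK c.rs c.base.T c.xcells)
    (hrip : c.checkRipples = true) (hsc : c.checkScalars = true) (hnuchk : c.checkNu = true) (hβ : β ≤ c.kappaQ)
    (hb1 : c.base.checkBlockP (fun k l ↦ c.base.prQ c.nuTab k l + rankOneQ R k l) (c.kappaQ - β) 1 = true)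
    (hlevel : ∀ t : ℝ, (c.base.T : ℝ) ≤ |t| → (c.wL : ℝ) ≤ weilTwoPrimeWeight t + ripplesVal c.rs t)
    {g : ℝ → ℂ} (hg : IsWeilTest g) (hsupp : tsupport g ⊆ Icc (-(c.b : ℝ)) c.b) (hodd : ∀ x, g (-x) = -g x) :
    (β : ℝ) * weilNorm2Sq g ≤ weilTwoPrimeQuadratic g +
      (R.map fun r ↦ (r.1 : ℝ) * ‖∑ k ∈ range (c.base.N + 1),
        ((maskV r k : ℚ) : ℂ) * weilMoment c.base.a0 g k‖ ^ 2).sum := by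
  obtain ⟨hbpos, -, hba, -, hT, -, -, hN, -⟩ := scalarsX_spec hsc
  have hadm := two_mul_b_le_abs_rippleFreq hX hT hrip
  have hb0' : (0 : ℝ) < c.b := by exact_mod_cast hbpos
  have hba' : ((c.b : ℚ) : ℝ) ≤ (c.base.a0 : ℝ) := by exact_mod_cast hba
  have ha : (0 : ℝ) < (c.base.a0 : ℝ) := by linarith
  have hsupp' : tsupport g ⊆ Icc (-(c.base.a0 : ℝ)) c.base.a0 := hsupp.trans (Icc_subset_Icc (by linarith) hba')
  have step3 := margin_step3 h23 hX hadm hlevel hsc hnuchk hg hsupp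
  have hbes := weilNorm2Sq_ge_bessel hg ha hsupp' (c.base.N + 1) (c.base.uVec (weilMoment c.base.a0 g))
  have hM : ∀ i, weilMoment c.base.a0 g (2 * i + (1 - 1)) = 0 := fun i ↦
    weilMoment_even_of_odd hodd _ ⟨i, by ring⟩
  have hcore := WeilCert.core_nonnegR_block (c := c.base) (nu := c.nuTab) (κ := c.kappaQ - β) R hN
    (p := 1) (by norm_num) hb1 (weilMoment c.base.a0 g) hM
  have hκ' : (0 : ℝ) ≤ ((c.kappaQ - β : ℚ) : ℝ) := by exact_mod_cast sub_nonneg.2 hβ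
  have h4 := mul_le_mul_of_nonneg_left hbes hκ'
  push_cast at hcore h4 ⊢
  nlinarith [step3, hcore, h4]

/-- **Both sectors from the two blocks separately** (format A′): the even block gives the bound for even tests, the odd block for odd tests —
the form in which a joint certificate `R = RE ++ RO` is consumed sector by sector (`dt_deflBound_even_of_append` / `…_odd_of_append`
then drop the other sector's penalties). [folklore] -/
theorem weilTwoPrimeQuadratic_rankOne_bound_of_parts_of_parity {β : ℚ} {R : List (ℚ × ℕ × List ℚ)} {p : ℕ} (hp : p < 2)
    (h23 : CellsOK₂₃ c.base.wL c.base.T c.cells) (hX : XCellsOK c.rs c.base.T c.xcells)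
    (hrip : c.checkRipples = true) (hsc : c.checkScalars = true) (hnuchk : c.checkNu = true) (hβ : β ≤ c.kappaQ)
    (hb : c.base.checkBlockP (fun k l ↦ c.base.prQ c.nuTab k l + rankOneQ R k l) (c.kappaQ - β) p = true)
    (hlevel : ∀ t : ℝ, (c.base.T : ℝ) ≤ |t| → (c.wL : ℝ) ≤ weilTwoPrimeWeight t + ripplesVal c.rs t)
    {g : ℝ → ℂ} (hg : IsWeilTest g) (hsupp : tsupport g ⊆ Icc (-(c.b : ℝ)) c.b) (hpar : ∀ x, g (-x) = (-1) ^ p * g x) :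
    (β : ℝ) * weilNorm2Sq g ≤ weilTwoPrimeQuadratic g +
      (R.map fun r ↦ (r.1 : ℝ) * ‖∑ k ∈ range (c.base.N + 1),
        ((maskV r k : ℚ) : ℂ) * weilMoment c.base.a0 g k‖ ^ 2).sum := by
  obtain ⟨hbpos, -, hba, -, hT, -, -, hN, -⟩ := scalarsX_spec hsc
  have hadm := two_mul_b_le_abs_rippleFreq hX hT hrip
  have hb0' : (0 : ℝ) < c.b := by exact_mod_cast hbpos
  have hba' : ((c.b : ℚ) : ℝ) ≤ (c.base.a0 : ℝ) := by exact_mod_cast hba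
  have ha : (0 : ℝ) < (c.base.a0 : ℝ) := by linarith
  have hsupp' : tsupport g ⊆ Icc (-(c.base.a0 : ℝ)) c.base.a0 := hsupp.trans (Icc_subset_Icc (by linarith) hba')
  have step3 := margin_step3 h23 hX hadm hlevel hsc hnuchk hg hsupp
  have hbes := weilNorm2Sq_ge_bessel hg ha hsupp' (c.base.N + 1) (c.base.uVec (weilMoment c.base.a0 g))
  have hM : ∀ i, weilMoment c.base.a0 g (2 * i + (1 - p)) = 0 := by
    intro i
    interval_cases p
    · exact weilMoment_odd_of_even (fun x ↦ by simpa using hpar x) _ ⟨i, by ring⟩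
    · exact weilMoment_even_of_odd (fun x ↦ by simpa using hpar x) _ ⟨i, by ring⟩
  have hcore := WeilCert.core_nonnegR_block (c := c.base) (nu := c.nuTab) (κ := c.kappaQ - β) R hN hp hb
    (weilMoment c.base.a0 g) hM
  have hκ' : (0 : ℝ) ≤ ((c.kappaQ - β : ℚ) : ℝ) := by exact_mod_cast sub_nonneg.2 hβ
  have h4 := mul_le_mul_of_nonneg_left hbes hκ'
  push_cast at hcore h4 ⊢
  nlinarith [step3, hcore, h4]

end WeilCert23X

end Summit.RiemannHypothesis.RiemannHypothesis.Theorems.EvenWinsBeyondArch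

end
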